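import Literature.Analysis.FluidPDE.PassiveScalarDiagMild
import HarnessLib

/-!
# Mild (Duhamel) formulation of the passive scalar equation with constant diagonal diffusion and
  bounded drift, VII: the per-mode weak identity and the Fourier dictionary of test functions

Analysis/FluidPDE proof-support file (everything proved). Two ingredients of "mild ⇒ weak":
* `mild_mode_weak_identity`: if `c(t) = e^{-νt}c₀ - ∫_{(0,t]} e^{-ν(t-s)}N(s)ds` on `[0,T]` with
  `N ∈ L¹(0,T)`, then `∫₀ᵀ (cφ' - νcφ - Nφ) + c₀φ(0) = 0` for every `C¹` `φ` vanishing near `T` — by a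
  complex-valued integration by parts against a primitive (Fubini on the triangle; no
  differentiability of the primitive);
* the slice Fourier coefficients `ψ̂(t)(k)` of a real space–time test function (`Torus.testCoeff`):
  `d/dt ψ̂(t)(k) = 𝓕(∂ₜψ(t))(k)`, continuity, uniform polynomial decay on `[0,T]`, vanishing near `T`,
  `𝓕(∂ⱼφ)(k) = 2πikⱼφ̂(k)`, `𝓕(∑ᵢaᵢ∂ᵢ∂ᵢφ)(k) = -4π²Qₐ(k)φ̂(k)`, and Parseval for real pairings.

## References

* A. Pazy, *Semigroups of Linear Operators and Applications to PDE*, Springer 1983, Ch. 4 §4.2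
  (mild solutions, (2.3), Def. 2.3), Ch. 6 §6.1 Thm. 1.2 (Picard iteration for the mild equation).
* R. J. DiPerna, P.-L. Lions, Invent. Math. 98 (1989) 511–547, §II.1. L. C. Evans, *PDE* (2010), §7.1.2.
* L. Grafakos, *Classical Fourier Analysis*, 3rd ed. (2014), Prop. 3.2.6 (4), (8), Prop. 3.2.7 (3), §3.3.1.
* J. C. Robinson, J. L. Rodrigo, W. Sadowski, *The Three-Dimensional Navier–Stokes Equations* (2016), Thm. 4.11.
-/

noncomputable section

open MeasureTheory TopologicalSpace Set Function Filter UnitAddTorus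
open _root_.Topology
open scoped ENNReal NNReal InnerProductSpace ComplexConjugate

namespace Literature.Analysis.FluidPDE

namespace Torus

open Literature.Analysis.FunctionSpaces.Torus Literature.Analysis.FunctionSpaces

variable {d : Type*} [Fintype d]

/-! ## Mild ⇒ weak, I: the per-mode identity (integration by parts against a primitive) -/

section PerMode

omit [Fintype d]

/-- **Integration by parts against a primitive** (complex-valued): for `f ∈ L¹(0,T)` and `χ` with a
continuous derivative `χ'` everywhere,
`∫_{(0,T)} χ'(s) (∫_{(0,s)} f) ds = χ(T) ∫_{(0,T)} f - ∫_{(0,T)} χ(s) f(s) ds`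
(Fubini on the triangle `{τ < s}` and the fundamental theorem of calculus for `χ` on `[τ, T]`; no
differentiability of the primitive is used — as in the tree's real-valued
`FunctionSpaces.setIntegral_deriv_mul_const_add_setIntegral`). [cite: Pazy1983, Ch. 4 §4.2, (2.2)–(2.3), p. 105] -/
theorem setIntegral_deriv_mul_primitive_complex {T : ℝ} {χ χ' : ℝ → ℂ}
    (hχ : ∀ s, HasDerivAt χ (χ' s) s) (hχ'c : Continuous χ') {f : ℝ → ℂ} (hf : IntegrableOn f (Ioo 0 T)) :
    ∫ s in Ioo 0 T, χ' s * ∫ τ in Ioo 0 s, f τ =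
      χ T * (∫ τ in Ioo 0 T, f τ) - ∫ s in Ioo 0 T, χ s * f s := by
  have hχc : Continuous χ := continuous_iff_continuousAt.2 fun s => (hχ s).continuousAt
  -- WLOG `f` vanishes outside `(0, T)`
  set g : ℝ → ℂ := (Ioo 0 T).indicator f with hg
  have hgi : IntegrableOn g (Ioo 0 T) := (hf.integrable_indicator measurableSet_Ioo).integrableOn
  have hgf : ∀ s, s ≤ T → ∫ τ in Ioo 0 s, g τ = ∫ τ in Ioo 0 s, f τ := fun s hs =>
    setIntegral_congr_fun measurableSet_Ioo fun τ hτ =>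
      indicator_of_mem (show τ ∈ Ioo 0 T from ⟨hτ.1, lt_of_lt_of_le hτ.2 hs⟩) f
  have hgf' : ∀ h : ℝ → ℂ, ∫ s in Ioo 0 T, h s * g s = ∫ s in Ioo 0 T, h s * f s := fun h =>
    setIntegral_congr_fun measurableSet_Ioo fun s hs => by rw [hg, indicator_of_mem hs]
  -- `χ`, `χ'` are integrable on `(0, T)`
  have hχ'i : IntegrableOn χ' (Ioo 0 T) := hχ'c.integrableOn_Icc.mono_set Ioo_subset_Icc_self
  obtain ⟨D, hD⟩ : ∃ D, ∀ s ∈ Icc 0 T, ‖χ s‖ ≤ D :=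
    isCompact_Icc.exists_bound_of_continuousOn hχc.continuousOn
  have hχgi : IntegrableOn (fun s => χ s * g s) (Ioo 0 T) := by
    refine Integrable.mono' (hgi.norm.const_mul D)
      ((hχc.aestronglyMeasurable.restrict).mul hgi.aestronglyMeasurable) ?_
    filter_upwards [ae_restrict_mem measurableSet_Ioo] with s hs
    rw [norm_mul]
    exact mul_le_mul_of_nonneg_right (hD s (Ioo_subset_Icc_self hs)) (norm_nonneg _)
  -- the triangle integrand
  set F : ℝ → ℝ → ℂ := fun s τ => (Iio s).indicator (fun τ => χ' s * g τ) τ with hF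
  have hFK : uncurry F = {p : ℝ × ℝ | p.2 < p.1}.indicator fun p => χ' p.1 * g p.2 := by
    ext p
    simp only [hF, uncurry, indicator_apply, mem_Iio, mem_setOf_eq]
  have hFi : Integrable (uncurry F)
      ((volume.restrict (Ioo 0 T)).prod (volume.restrict (Ioo 0 T))) := by
    rw [hFK]
    exact (hχ'i.mul_prod hgi).indicator (measurableSet_lt measurable_snd measurable_fst)
  -- inner integral in `τ` for fixed `s`
  have hinner₁ : ∀ s ∈ Ioo 0 T, ∫ τ in Ioo 0 T, F s τ = χ' s * ∫ τ in Ioo 0 s, g τ := by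
    intro s hs
    simp only [hF]
    rw [setIntegral_indicator measurableSet_Iio, Ioo_inter_Iio, min_eq_right hs.2.le, integral_const_mul]
  -- inner integral in `s` for fixed `τ`
  have hinner₂ : ∀ τ ∈ Ioo 0 T, ∫ s in Ioo 0 T, F s τ = (χ T - χ τ) * g τ := by
    intro τ hτ
    have hpt : (fun s => F s τ) = (Ioi τ).indicator fun s => χ' s * g τ := by
      ext s
      simp only [hF, indicator_apply, mem_Iio, mem_Ioi]
    rw [hpt, setIntegral_indicator measurableSet_Ioi, Ioo_inter_Ioi, max_eq_right hτ.1.le,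
      integral_mul_const, setIntegral_Ioo_eq_sub_of_hasDerivAt' hχ hχ'c hτ.2.le]
  -- Fubini
  have hswap := integral_integral_swap hFi
  have hL : ∫ s in Ioo 0 T, ∫ τ in Ioo 0 T, F s τ = ∫ s in Ioo 0 T, χ' s * ∫ τ in Ioo 0 s, f τ := by
    refine setIntegral_congr_fun measurableSet_Ioo fun s hs => ?_
    rw [hinner₁ s hs, hgf s hs.2.le]
  have hR : ∫ τ in Ioo 0 T, ∫ s in Ioo 0 T, F s τ =
      χ T * (∫ τ in Ioo 0 T, f τ) - ∫ s in Ioo 0 T, χ s * f s := by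
    rw [setIntegral_congr_fun measurableSet_Ioo hinner₂]
    have : (fun τ => (χ T - χ τ) * g τ) = fun τ => χ T * g τ - χ τ * g τ := by
      ext τ; ring
    rw [this, integral_sub (hgi.const_mul _) hχgi, integral_const_mul, hgf' χ]
    have h1 := hgf' (fun _ => (1 : ℂ))
    simp only [one_mul] at h1
    rw [h1]
  rw [← hL, hswap, hR]
where
  /-- FTC on `(a,b)` for a complex function with a continuous derivative. -/
  setIntegral_Ioo_eq_sub_of_hasDerivAt' {χ χ' : ℝ → ℂ} (hχ : ∀ s, HasDerivAt χ (χ' s) s)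
      (hχ'c : Continuous χ') {a b : ℝ} (hab : a ≤ b) : ∫ s in Ioo a b, χ' s = χ b - χ a := by
    rw [← integral_Ioc_eq_integral_Ioo, ← intervalIntegral.integral_of_le hab]
    exact intervalIntegral.integral_eq_sub_of_hasDerivAt (fun s _ => hχ s) (hχ'c.intervalIntegrable _ _)

/-- **The per-mode identity (mild ⇒ weak, one Fourier mode).** Let `ν ∈ ℝ`, `c0 ∈ ℂ`,
`N ∈ L¹(0,T)` and let `c(t) = e^{-νt} c0 - ∫_{(0,t]} e^{-ν(t-s)} N(s) ds` on `[0,T]` (the mild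
equation of one mode). Then for every `φ : ℝ → ℂ` with a continuous derivative `φ'` and
`φ = 0` on `[T', ∞)` for some `T' < T`,
`∫_{(0,T)} (c φ' - ν c φ - N φ) dt + c0 φ(0) = 0` — the weak form of `c' = -νc - N`, `c(0) = c0`
(Pazy 1983, Ch. 4 §4.2: a mild solution is a weak solution; here by integration by parts against
the primitive with `χ = e^{-ν·} φ`). [cite: Pazy1983, Ch. 4 §4.2, Def. 2.3–Thm. 2.4, pp. 106–107] -/
theorem mild_mode_weak_identity {T ν : ℝ} (hT : 0 < T) {c0 : ℂ} {N c : ℝ → ℂ}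
    (hN : IntegrableOn N (Ioo 0 T))
    (hc : ∀ t ∈ Icc 0 T, c t = ((Real.exp (-(ν * t)) : ℝ) : ℂ) * c0 -
      ∫ s in Ioc 0 t, ((Real.exp (-(ν * (t - s))) : ℝ) : ℂ) * N s)
    {φ φ' : ℝ → ℂ} (hφ : ∀ t, HasDerivAt φ (φ' t) t) (hφ'c : Continuous φ')
    {T' : ℝ} (hT' : T' < T) (hφ0 : ∀ t, T' ≤ t → φ t = 0) :
    (∫ t in Ioo 0 T, (c t * φ' t - ν * c t * φ t - N t * φ t)) + c0 * φ 0 = 0 := by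
  have hφc : Continuous φ := continuous_iff_continuousAt.2 fun s => (hφ s).continuousAt
  have hφT : φ T = 0 := hφ0 T hT'.le
  -- `χ = e^{-ν·} φ`, `χ' = e^{-ν·} (φ' - ν φ)`
  set E : ℝ → ℂ := fun t => ((Real.exp (-(ν * t)) : ℝ) : ℂ) with hE
  set χ : ℝ → ℂ := fun t => E t * φ t with hχ
  set χ' : ℝ → ℂ := fun t => E t * (φ' t - ν * φ t) with hχ'
  have hEd : ∀ t, HasDerivAt E (-ν * E t) t := by
    intro t
    have h1 : HasDerivAt (fun t : ℝ => -(ν * t)) (-ν) t := by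
      have e : (fun t : ℝ => -(ν * t)) = fun t => -ν * t := by funext t; ring
      rw [e]
      simpa using (hasDerivAt_id t).const_mul (-ν)
    have h2 := (h1.exp).ofReal_comp
    have e2 : -ν * E t = ((Real.exp (-(ν * t)) * -ν : ℝ) : ℂ) := by
      simp only [hE]; push_cast; ring
    rw [e2]
    exact h2
  have hχd : ∀ t, HasDerivAt χ (χ' t) t := by
    intro t
    have h := (hEd t).mul (hφ t)
    have e : χ' t = -ν * E t * φ t + E t * φ' t := by simp only [hχ']; ring
    rw [e]
    exact h
  have hEc : Continuous E := Complex.continuous_ofReal.comp (Real.continuous_exp.comp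
    (continuous_const.mul continuous_id).neg)
  have hχ'c : Continuous χ' := hEc.mul (hφ'c.sub (continuous_const.mul hφc))
  -- the weighted transport coefficient `M(s) = e^{νs} N(s)` and its primitive
  set M : ℝ → ℂ := fun s => ((Real.exp (ν * s) : ℝ) : ℂ) * N s with hM
  have hMi : IntegrableOn M (Ioo 0 T) := by
    refine hN.bdd_mul (c := Real.exp (|ν| * T))
      (Complex.continuous_ofReal.comp (Real.continuous_exp.comp (continuous_const.mul continuous_id))
        |>.aestronglyMeasurable) ?_
    filter_upwards [ae_restrict_mem measurableSet_Ioo] with s hs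
    rw [Complex.norm_real, Real.norm_of_nonneg (Real.exp_pos _).le, Real.exp_le_exp]
    calc ν * s ≤ |ν| * s := mul_le_mul_of_nonneg_right (le_abs_self ν) hs.1.le
      _ ≤ |ν| * T := mul_le_mul_of_nonneg_left hs.2.le (abs_nonneg ν)
  -- `c(t) = E t * (c0 - ∫_{(0,t)} M)` on `[0,T]`
  have hc' : ∀ t ∈ Icc 0 T, c t = E t * c0 - E t * ∫ s in Ioo 0 t, M s := by
    intro t ht
    rw [hc t ht, ← integral_Ioc_eq_integral_Ioo, ← integral_const_mul]
    congr 1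
    refine integral_congr_ae (ae_of_all _ fun s => ?_)
    simp only [hE, hM]
    rw [← mul_assoc, ← Complex.ofReal_mul, ← Real.exp_add]
    congr 3
    ring
  -- the three pieces
  have hIBP := setIntegral_deriv_mul_primitive_complex hχd hχ'c hMi
  have hχT : χ T = 0 := by simp only [hχ, hφT, mul_zero]
  have hχ0 : χ 0 = φ 0 := by simp [hχ, hE]
  have hFTC : ∫ s in Ioo 0 T, χ' s = χ T - χ 0 :=
    setIntegral_deriv_mul_primitive_complex.setIntegral_Ioo_eq_sub_of_hasDerivAt' hχd hχ'c hT.le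
  -- `χ M = φ N`
  have hχM : ∀ s, χ s * M s = N s * φ s := by
    intro s
    simp only [hχ, hM, hE]
    have : ((Real.exp (-(ν * s)) : ℝ) : ℂ) * ((Real.exp (ν * s) : ℝ) : ℂ) = 1 := by
      rw [← Complex.ofReal_mul, ← Real.exp_add]; simp
    calc ((Real.exp (-(ν * s)) : ℝ) : ℂ) * φ s * (((Real.exp (ν * s) : ℝ) : ℂ) * N s)
        = (((Real.exp (-(ν * s)) : ℝ) : ℂ) * ((Real.exp (ν * s) : ℝ) : ℂ)) * (N s * φ s) := by ring
      _ = N s * φ s := by rw [this, one_mul]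
  -- rewrite the integrand on `(0,T)`: `c φ' - ν c φ = (c0 - ∫M) χ'`
  have hint_eq : ∫ t in Ioo 0 T, (c t * φ' t - ν * c t * φ t - N t * φ t) =
      ∫ t in Ioo 0 T, (c0 * χ' t - χ' t * (∫ s in Ioo 0 t, M s) - χ t * M t) := by
    refine setIntegral_congr_fun measurableSet_Ioo fun t ht => ?_
    rw [hc' t (Ioo_subset_Icc_self ht), hχM t]
    simp only [hχ']
    ring
  -- integrability of the pieces
  have hχ'i : IntegrableOn χ' (Ioo 0 T) := hχ'c.integrableOn_Icc.mono_set Ioo_subset_Icc_self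
  have hχc' : Continuous χ := continuous_iff_continuousAt.2 fun s => (hχd s).continuousAt
  have hPi : IntegrableOn (fun t => χ' t * ∫ s in Ioo 0 t, M s) (Ioo 0 T) := by
    have hprim : ContinuousOn (fun t => ∫ s in Ioc 0 t, M s) (Icc 0 T) :=
      intervalIntegral.continuousOn_primitive
        ((integrableOn_Icc_iff_integrableOn_Ioo (f := M) (μ := (volume : Measure ℝ))).2 hMi)
    have h2 : ContinuousOn (fun t => χ' t * ∫ s in Ioc 0 t, M s) (Icc 0 T) := hχ'c.continuousOn.mul hprim
    refine ((h2.integrableOn_compact isCompact_Icc).mono_set Ioo_subset_Icc_self).congr ?_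
    exact ae_of_all _ fun t => by
      show χ' t * ∫ s in Ioc 0 t, M s = χ' t * ∫ s in Ioo 0 t, M s
      rw [integral_Ioc_eq_integral_Ioo]
  have hχMi : IntegrableOn (fun t => χ t * M t) (Ioo 0 T) := by
    obtain ⟨D, hD⟩ : ∃ D, ∀ s ∈ Icc 0 T, ‖χ s‖ ≤ D :=
      isCompact_Icc.exists_bound_of_continuousOn hχc'.continuousOn
    refine hMi.bdd_mul (c := D) hχc'.aestronglyMeasurable ?_
    filter_upwards [ae_restrict_mem measurableSet_Ioo] with s hs
    exact hD s (Ioo_subset_Icc_self hs)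
  have hI1 : Integrable (fun t => c0 * χ' t) ((volume : Measure ℝ).restrict (Ioo 0 T)) := hχ'i.const_mul c0
  have hI2 : Integrable (fun t => c0 * χ' t - χ' t * ∫ s in Ioo 0 t, M s)
      ((volume : Measure ℝ).restrict (Ioo 0 T)) := hI1.sub hPi
  rw [hint_eq, integral_sub hI2 hχMi, integral_sub hI1 hPi, integral_const_mul, hIBP, hFTC, hχT, hχ0]
  ring

end PerMode

/-! ## Mild ⇒ weak, II: the Fourier dictionary for test functions, and Parseval pairings -/

section TestCoeff

variable [DecidableEq d]

/-- The complex Fourier coefficients of the time slices of a real space–time function,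
`ψ̂(t)(k) = 𝓕(ψ(t))(k)`. [cite: Grafakos2014, Prop. 3.2.6 (8)] -/
def testCoeff (ψ : ℝ → UnitAddTorus d → ℝ) (t : ℝ) (k : d → ℤ) : ℂ :=
  mFourierCoeff (fun x => (ψ t x : ℂ)) k

omit [DecidableEq d] in
/-- Unfolding `testCoeff`. [cite: Grafakos2014, Prop. 3.2.6 (8)] -/
theorem testCoeff_apply (ψ : ℝ → UnitAddTorus d → ℝ) (t : ℝ) (k : d → ℤ) :
    testCoeff ψ t k = mFourierCoeff (fun x => (ψ t x : ℂ)) k := rfl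

omit [DecidableEq d] in
/-- The complexification of a space–time test function is jointly smooth on every time set. [cite: Grafakos2014, Prop. 3.2.6 (8)] -/
theorem isSmoothSpaceTimeOn_ofReal_test {T : ℝ} {ψ : ℝ → UnitAddTorus d → ℝ} (hψ : IsSpaceTimeTest T ψ)
    (S : Set ℝ) : FunctionSpaces.Torus.IsSmoothSpaceTimeOn S (fun t x => (ψ t x : ℂ)) :=
  (hψ.isSmoothSpaceTimeOn S).clm_comp Complex.ofRealCLM

omit [DecidableEq d] in
/-- **Time derivative of the slice coefficients of a test function**:
`d/dt ψ̂(t)(k) = 𝓕(∂ₜψ(t))(k)` at every `t` (differentiation under the torus integral). [cite: Grafakos2014, Prop. 3.2.6 (8)] -/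
theorem hasDerivAt_testCoeff {T : ℝ} {ψ : ℝ → UnitAddTorus d → ℝ} (hψ : IsSpaceTimeTest T ψ) (t : ℝ)
    (k : d → ℤ) : HasDerivAt (fun s => testCoeff ψ s k) (testCoeff (FunctionSpaces.Torus.timeDeriv ψ) t k) t := by
  have hΨ := isSmoothSpaceTimeOn_ofReal_test hψ univ
  have h := ScalarFourier.hasDerivWithinAt_mFourierCoeff hΨ convex_univ uniqueDiffOn_univ (mem_univ t) k
  have h' := h.hasDerivAt univ_mem
  have e : FunctionSpaces.Torus.timeDerivWithin univ (fun t x => (ψ t x : ℂ)) t =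
      fun x => ((FunctionSpaces.Torus.timeDeriv ψ t x : ℝ) : ℂ) := by
    funext x
    have hslice : HasDerivWithinAt (fun τ => ψ τ x) (FunctionSpaces.Torus.timeDerivWithin univ ψ t x) univ t :=
      (hψ.isSmoothSpaceTimeOn univ).hasDerivWithinAt_slice (mem_univ t) x
    have h1 : HasDerivAt (fun τ => ψ τ x) (FunctionSpaces.Torus.timeDeriv ψ t x) t := by
      have := hslice.hasDerivAt univ_mem
      rwa [timeDerivWithin_eq_timeDeriv_of_contDiff hψ.1 uniqueDiffOn_univ (mem_univ t) x] at this
    have h2 := h1.ofReal_comp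
    rw [FunctionSpaces.Torus.timeDerivWithin, derivWithin_univ]
    exact h2.deriv
  rw [e] at h'
  exact h'

omit [DecidableEq d] in
/-- The slice coefficients of a test function are continuous in time. [cite: Grafakos2014, Prop. 3.2.6 (8)] -/
theorem continuous_testCoeff {T : ℝ} {ψ : ℝ → UnitAddTorus d → ℝ} (hψ : IsSpaceTimeTest T ψ) (k : d → ℤ) :
    Continuous fun t => testCoeff ψ t k :=
  continuous_iff_continuousAt.2 fun t => (hasDerivAt_testCoeff hψ t k).continuousAt

/-- **Uniform polynomial decay of the slice coefficients of a test function** on `[0,T]`. [cite: Grafakos2014, §3.3.1] -/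
theorem exists_hasDecay_testCoeff {T : ℝ} (hT : 0 < T) {ψ : ℝ → UnitAddTorus d → ℝ}
    (hψ : IsSpaceTimeTest T ψ) (K : ℕ) :
    ∃ C : ℝ, 0 ≤ C ∧ ∀ t ∈ Icc 0 T, FourierNS.HasDecay K C (testCoeff ψ t) :=
  ScalarFourier.exists_hasDecay_mFourierCoeff_spaceTime hT (isSmoothSpaceTimeOn_ofReal_test hψ (Icc 0 T)) K

omit [DecidableEq d] in
/-- The slice coefficients vanish where the test function does: there is `T' < T` with
`ψ̂(t) = 0` for `t ≥ T'`. [cite: Grafakos2014, Prop. 3.2.6 (8)] -/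
theorem exists_testCoeff_eq_zero {T : ℝ} {ψ : ℝ → UnitAddTorus d → ℝ} (hψ : IsSpaceTimeTest T ψ) :
    ∃ T' < T, ∀ t, T' ≤ t → ∀ k, testCoeff ψ t k = 0 := by
  obtain ⟨T', hT', h0⟩ := hψ.2
  refine ⟨T', hT', fun t ht k => ?_⟩
  rw [testCoeff_apply, h0 t ht]
  simp [mFourierCoeff_eq_integral_volume]

/-- **Spatial derivatives ↦ symbols**: `𝓕(∂ⱼφ)(k) = 2πi kⱼ φ̂(k)` for a smooth real `φ`. [cite: Grafakos2014, Prop. 3.2.6 (8)] -/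
theorem mFourierCoeff_ofReal_partialDeriv {φ : UnitAddTorus d → ℝ} (hφ : IsSmooth φ) (j : d) (k : d → ℤ) :
    mFourierCoeff (fun x => ((FunctionSpaces.Torus.partialDeriv j φ x : ℝ) : ℂ)) k =
      (2 * Real.pi * Complex.I * (k j : ℂ)) * mFourierCoeff (fun x => (φ x : ℂ)) k := by
  have hΦ : IsSmooth (fun x => (φ x : ℂ)) := hφ.ofReal_comp
  have h := mFourierCoeff_partialDeriv hΦ j k
  have e : FunctionSpaces.Torus.partialDeriv j (fun y => (φ y : ℂ)) = fun x => ((FunctionSpaces.Torus.partialDeriv j φ x : ℝ) : ℂ) :=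
    partialDeriv_ofReal_comp hφ j
  rw [e] at h
  rw [h, smul_eq_mul]

/-- **The diagonal operator ↦ its symbol**: `𝓕(∑ᵢ aᵢ ∂ᵢ∂ᵢφ)(k) = -4π² Qₐ(k) φ̂(k)` for a smooth
real `φ`. [cite: Grafakos2014, Prop. 3.2.6 (8)] -/
theorem mFourierCoeff_ofReal_diagOp {φ : UnitAddTorus d → ℝ} (hφ : IsSmooth φ) (a : d → ℝ) (k : d → ℤ) :
    mFourierCoeff (fun x => ((∑ i, a i * FunctionSpaces.Torus.partialDeriv i (FunctionSpaces.Torus.partialDeriv i φ) x : ℝ) : ℂ)) k =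
      -((4 * Real.pi ^ 2 * diagFreqSq a k : ℝ) : ℂ) * mFourierCoeff (fun x => (φ x : ℂ)) k := by
  have hint : ∀ i ∈ (Finset.univ : Finset d),
      Integrable (fun x => ((a i * FunctionSpaces.Torus.partialDeriv i (FunctionSpaces.Torus.partialDeriv i φ) x : ℝ) : ℂ)) volume := fun i _ =>
    ((continuous_const.mul ((hφ.partialDeriv i).partialDeriv i).continuous).integrable_unitAddTorus).ofReal
  have e : (fun x => ((∑ i, a i * FunctionSpaces.Torus.partialDeriv i (FunctionSpaces.Torus.partialDeriv i φ) x : ℝ) : ℂ)) =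
      fun x => ∑ i, ((a i * FunctionSpaces.Torus.partialDeriv i (FunctionSpaces.Torus.partialDeriv i φ) x : ℝ) : ℂ) := by
    funext x; push_cast; rfl
  rw [e, mFourierCoeff_finset_sum _ hint]
  have e2 : ∀ i, mFourierCoeff (fun x => ((a i * FunctionSpaces.Torus.partialDeriv i (FunctionSpaces.Torus.partialDeriv i φ) x : ℝ) : ℂ)) k =
      (a i : ℂ) * ((2 * Real.pi * Complex.I * (k i : ℂ)) * ((2 * Real.pi * Complex.I * (k i : ℂ)) *
        mFourierCoeff (fun x => (φ x : ℂ)) k)) := by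
    intro i
    have e3 : (fun x => ((a i * FunctionSpaces.Torus.partialDeriv i (FunctionSpaces.Torus.partialDeriv i φ) x : ℝ) : ℂ)) =
        (a i : ℂ) • fun x => ((FunctionSpaces.Torus.partialDeriv i (FunctionSpaces.Torus.partialDeriv i φ) x : ℝ) : ℂ) := by
      funext x; simp only [Pi.smul_apply, smul_eq_mul]; push_cast; ring
    rw [e3, mFourierCoeff_const_smul, smul_eq_mul, mFourierCoeff_ofReal_partialDeriv (hφ.partialDeriv i),
      mFourierCoeff_ofReal_partialDeriv hφ]
  simp_rw [e2]
  rw [diagFreqSq_apply]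
  push_cast
  rw [Finset.mul_sum, neg_mul, Finset.sum_mul, ← Finset.sum_neg_distrib]
  refine Finset.sum_congr rfl fun i _ => ?_
  have hI : Complex.I * Complex.I = -1 := Complex.I_mul_I
  linear_combination (2 * (Real.pi : ℂ)) ^ 2 * (a i : ℂ) * (k i : ℂ) ^ 2 *
    mFourierCoeff (fun x => (φ x : ℂ)) k * hI

omit [DecidableEq d] in
/-- **Parseval for a real pairing**: `∫ f g = ∑ₖ conj(ĝ(k)) f̂(k)` for real `f, g ∈ L²(T^d)`
(as a `HasSum` in `ℂ`). [cite: Grafakos2014, Prop. 3.2.7 (3)] -/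
theorem hasSum_conj_mul_mFourierCoeff_ofReal {f g : UnitAddTorus d → ℝ} (hf : MemLp f 2 volume)
    (hg : MemLp g 2 volume) :
    HasSum (fun k : d → ℤ => conj (mFourierCoeff (fun x => (g x : ℂ)) k) * mFourierCoeff (fun x => (f x : ℂ)) k)
      (((∫ x, f x * g x : ℝ) : ℂ)) := by
  have h := hasSum_conj_mul_mFourierCoeff (g := fun x => (g x : ℂ)) (h := fun x => (f x : ℂ)) hg.ofReal hf.ofReal
  have e : (∫ x, starRingEnd ℂ ((g x : ℝ) : ℂ) * ((f x : ℝ) : ℂ)) = (((∫ x, f x * g x : ℝ) : ℂ)) := by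
    rw [← integral_complex_ofReal]
    refine integral_congr_ae (ae_of_all _ fun x => ?_)
    dsimp only
    rw [Complex.conj_ofReal]; push_cast; ring
  rwa [e] at h

end TestCoeff

end Torus

end Literature.Analysis.FluidPDE

end
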